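import Summits.Ventures.PercRepro.PendantFibre

/-!
# PercRepro — `(5a)_class` is a theorem: `PendantClassSumNonneg` (p1, gen 4; proofs/P1-5a-class.md)

For a pendant mark `a = m 0` with its edge `g`, typer-2's identity (`pendantClassSumNonneg_iff`) reads
the class-level pendant Lemma 5a as `CS₁(G, g) ≤ 2·CS(G)`, i.e. `X(f₁, f₁) ≤ X(f₁, f₀)` on the cube of `E ∖ {g}`
(`f_b = facetRow g m b`).  Proof: `f₀ ρᶜ = splitA (f₁ ρᶜ)` (`row4_extendAt_false`), so the difference is a row
kernel; moving the `(⊤, A-row)` count to the `(A-row, ⊤)` side by the involution `ρ ↦ ρᶜ`, it is bounded by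
`−kf` pointwise (`kd_le_neg_kf`); and `0 ≤ Σ_ρ kf (f₁ ρ) (f₁ ρᶜ)` (`sum_kf_nonneg`) by summing over the fibres of
`pkey`: in a fibre with exactly one mark in the cluster the X-row is the B-row or the A-row of that mark according
to `q ~ r` (`facetRow_fibre_*`), and the two-map coordinate induction with the fibre kernel `fB` applies
(`fibre_sum_nonneg`); in every other fibre `kf` vanishes (`fibre_sum_zero`).
-/

namespace PercRepro

open Finset

/-- `extendAt` is monotone in the configuration. -/
theorem extendAt_le_extendAt {S : Type*} [DecidableEq S] (k : S) (b : Bool) {σ σ' : Config {s // s ≠ k}}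
    (h : σ ≤ σ') : extendAt k b σ ≤ extendAt k b σ' := by
  intro s
  by_cases hs : s = k
  · subst hs
    rw [extendAt_self, extendAt_self]
  · rw [extendAt_of_ne k b σ hs, extendAt_of_ne k b σ' hs]
    exact h _

/-- The free-coordinate indicator with `k` closed lies below any extension by `true` of a larger set. -/
theorem extendAt_false_decide_le {S : Type*} [DecidableEq S] (k : S) (γ : Config {s // s ≠ k})
    (B : Finset {s // s ≠ k}) :
    extendAt k false (fun e => decide (e ∈ B)) ≤ extendAt k true (cfgOf γ B) := by
  intro s
  by_cases hs : s = k
  · subst hs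
    rw [extendAt_self, extendAt_self]
    exact Bool.false_le _
  · rw [extendAt_of_ne k false _ hs, extendAt_of_ne k true _ hs]
    simp only [cfgOf]
    cases γ ⟨s, hs⟩ <;> simp

namespace MultiGraph

variable {V E : Type*} (G : MultiGraph V E) [Fintype E] [DecidableEq E]

omit [Fintype E] in
open Classical in
/-- The Y-row is monotone for the refinement order on rows. -/
theorem rowLe_facetRow {g : E} (m : Fin 4 → V) {τ τ' : Config {e // e ≠ g}} (h : τ ≤ τ') :
    RowLe (G.facetRow g m true τ) (G.facetRow g m true τ') := by
  intro i hi
  simp only [facetRow, row4] at hi ⊢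
  rw [rows4_rowOf4 _ (isEquivAtoms4_atoms4 _), G.atoms4_markedPartition, decide_eq_true_iff] at hi ⊢
  exact hi.mono (extendAt_le_extendAt g true h)

/-- The atoms of a fibre row: the pairs with the pendant mark read the cluster membership. -/
theorem conn_fibre_zero_iff {g : E} (m : Fin 4 → V) (ρ₀ : Config {e // e ≠ g}) {B : Finset {e // e ≠ g}}
    (hB : B ⊆ G.outF g (m 0) ρ₀) (j : Fin 4) :
    G.Conn (extendAt g true (cfgOf (G.pkey g (m 0) ρ₀) B)) (m 0) (m j) ↔ m j ∈ G.pcluster g (m 0) ρ₀ := by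
  rw [← G.pcluster_cfgOf_eq ρ₀ hB]
  rfl

/-- Two marks, one inside the cluster and one outside, are not connected on the fibre. -/
theorem not_conn_fibre {g : E} (m : Fin 4 → V) (ρ₀ : Config {e // e ≠ g}) {B : Finset {e // e ≠ g}}
    (hB : B ⊆ G.outF g (m 0) ρ₀) {i j : Fin 4} (hi : m i ∈ G.pcluster g (m 0) ρ₀)
    (hj : m j ∉ G.pcluster g (m 0) ρ₀) :
    ¬ G.Conn (extendAt g true (cfgOf (G.pkey g (m 0) ρ₀) B)) (m i) (m j) := fun h =>
  hj ((G.conn_fibre_zero_iff m ρ₀ hB j).1 (((G.conn_fibre_zero_iff m ρ₀ hB i).2 hi).trans h))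

/-- The touching edges contain `g`, and the key is supported on them. -/
theorem pkey_eq_false_of_not_touch {g : E} (m : Fin 4 → V) (hg : G.fst g = m 0 ∨ G.snd g = m 0)
    (ρ₀ : Config {e // e ≠ g}) :
    ∀ e ∉ G.touchF g (m 0) ρ₀, extendAt g true (G.pkey g (m 0) ρ₀) e = false := by
  intro e he
  by_cases heg : e = g
  · exfalso
    apply he
    rw [heg, mem_touchF]
    have h0 : m 0 ∈ G.pcluster g (m 0) ρ₀ := G.self_mem_cluster _ _
    rcases hg with h | h
    · exact Or.inl (h ▸ h0)
    · exact Or.inr (h ▸ h0)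
  · rw [extendAt_of_ne g true _ heg]
    simp only [pkey]
    cases hρ : ρ₀ ⟨e, heg⟩
    · rfl
    · rw [Bool.true_and, decide_eq_false_iff_not]
      intro hin
      exact he (mem_touchF.2 (Or.inl hin.1))

/-- **`q ~ r` on the X-side forces `q ~ r` on the Y-side** (diagonal condition): a connection between two marks
outside the cluster uses only free edges, which are open on the Y-side diagonal as well. -/
theorem conn_ybase_of_conn {g : E} (m : Fin 4 → V) (hg : G.fst g = m 0 ∨ G.snd g = m 0)
    (ρ₀ : Config {e // e ≠ g}) {B : Finset {e // e ≠ g}} (hB : B ⊆ G.outF g (m 0) ρ₀) {q r : Fin 4}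
    (hq : m q ∉ G.pcluster g (m 0) ρ₀)
    (h : G.Conn (extendAt g true (cfgOf (G.pkey g (m 0) ρ₀) B)) (m q) (m r)) :
    G.Conn (extendAt g true (cfgOf (G.ybase g (m 0) ρ₀) B)) (m q) (m r) := by
  have hK : ∀ e, e ∈ G.touchF g (m 0) ρ₀ ↔
      (G.fst e ∈ G.pcluster g (m 0) ρ₀ ∨ G.snd e ∈ G.pcluster g (m 0) ρ₀) := fun e => mem_touchF
  have hdec := G.extendAt_cfgOf_eq_sup (a := m 0) ρ₀ B
  have hcl : G.cluster (extendAt g true (G.pkey g (m 0) ρ₀) ⊔ extendAt g false (fun e => decide (e ∈ B)))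
      (m 0) = G.pcluster g (m 0) ρ₀ := by
    rw [← hdec]
    exact G.pcluster_cfgOf_eq ρ₀ hB
  have hcq := cluster_sup_eq_of_cluster_eq (G := G) (m 0) (m q) hK (G.pkey_eq_false_of_not_touch m hg ρ₀)
    hcl hq
  have hr : m r ∈ G.cluster (extendAt g false fun e => decide (e ∈ B)) (m q) := by
    rw [← hcq, ← hdec]
    exact h
  exact Conn.mono (extendAt_false_decide_le g _ B) hr

open Classical in
/-- **A fibre with exactly one mark in the cluster has a nonnegative `kf`-sum** (the two-map coordinate
induction with the fibre kernel `fB p`; `p` the B-row, `q r` the marks outside the cluster, `aqr` their atom). -/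
theorem fibre_sum_nonneg {g : E} (m : Fin 4 → V) (hg : G.fst g = m 0 ∨ G.snd g = m 0)
    (ρ₀ : Config {e // e ≠ g}) (p : Fin 15) (hp : p ∈ ({3, 6, 8} : Finset (Fin 15)))
    (q r : Fin 4) (aqr : Fin 6) (hpair : pair4 aqr = (q, r)) (hq : m q ∉ G.pcluster g (m 0) ρ₀)
    (hsep : ∀ t ∈ badRows p, rows4 t aqr = false)
    (hrow : ∀ B ⊆ G.outF g (m 0) ρ₀, G.facetRow g m true (cfgOf (G.pkey g (m 0) ρ₀) B) =
      if decide (G.Conn (extendAt g true (cfgOf (G.pkey g (m 0) ρ₀) B)) (m q) (m r)) then p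
      else aRowOf p) :
    0 ≤ ∑ B ∈ (G.outF g (m 0) ρ₀).powerset,
      (kf (G.facetRow g m true (cfgOf (G.pkey g (m 0) ρ₀) B))
        (G.facetRow g m true (cfgOf (G.pkey g (m 0) ρ₀) B)ᶜ) : ℝ) := by
  classical
  let c : Config {e // e ≠ g} → Bool := fun σ => decide (G.Conn (extendAt g true σ) (m q) (m r))
  have hc : ∀ σ σ' : Config {e // e ≠ g}, σ ≤ σ' → c σ ≤ c σ' := by
    intro σ σ' h
    simp only [c]
    by_cases hσ : G.Conn (extendAt g true σ) (m q) (m r)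
    · rw [decide_eq_true hσ, decide_eq_true (hσ.mono (extendAt_le_extendAt g true h))]
    · rw [decide_eq_false hσ]
      exact Bool.false_le _
  have hd : ∀ τ τ' : Config {e // e ≠ g}, τ ≤ τ' → RowLe (G.facetRow g m true τ) (G.facetRow g m true τ') :=
    fun _ _ h => G.rowLe_facetRow m h
  have hloc : ∀ (a₀ a₁ : Bool) (b₀ b₁ : Fin 15), a₀ ≤ a₁ → RowLe b₀ b₁ →
      (fB p a₀ b₀ : ℝ) + fB p a₁ b₁ ≤ fB p a₀ b₁ + fB p a₁ b₀ := by
    intro a₀ a₁ b₀ b₁ h1 h2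
    exact_mod_cast fB_loc p hp a₀ a₁ b₀ b₁ h1 h2
  have hdiag : ∀ B ⊆ G.outF g (m 0) ρ₀,
      (0 : ℝ) ≤ fB p (c (cfgOf (G.pkey g (m 0) ρ₀) B)) (G.facetRow g m true (cfgOf (G.ybase g (m 0) ρ₀) B)) := by
    intro B hB
    by_cases hcB : G.Conn (extendAt g true (cfgOf (G.pkey g (m 0) ρ₀) B)) (m q) (m r)
    · have hY := G.conn_ybase_of_conn m hg ρ₀ hB hq hcB
      have hnot : G.facetRow g m true (cfgOf (G.ybase g (m 0) ρ₀) B) ∉ badRows p := by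
        intro hbad
        have h5 := hsep _ hbad
        simp only [facetRow, row4] at h5
        rw [rows4_rowOf4 _ (isEquivAtoms4_atoms4 _), G.atoms4_markedPartition, hpair,
          decide_eq_false_iff_not] at h5
        exact h5 hY
      simp [c, fB, decide_eq_true hcB, hnot]
    · by_cases ht : G.facetRow g m true (cfgOf (G.ybase g (m 0) ρ₀) B) = 0 <;>
        simp [c, fB, decide_eq_false hcB, ht]
  have key := twoMap_sum_nonneg (fun x y : Bool => x ≤ y) RowLe (fun x t => (fB p x t : ℝ)) hloc c
    (G.facetRow g m true) hc hd (G.outF g (m 0) ρ₀) (G.pkey g (m 0) ρ₀) (G.ybase g (m 0) ρ₀) hdiag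
  refine le_of_le_of_eq key (Finset.sum_congr rfl fun B hB => ?_)
  rw [Finset.mem_powerset] at hB
  rw [hrow B hB, G.compl_cfgOf_pkey ρ₀ hB]
  have := kf_eq_fB p hp (c (cfgOf (G.pkey g (m 0) ρ₀) B))
    (G.facetRow g m true (cfgOf (G.ybase g (m 0) ρ₀) (G.outF g (m 0) ρ₀ \ B)))
  simp only [c] at this ⊢
  rw [← this]

open Classical in
/-- The X-row on a fibre whose cluster contains `m 1` only: `ab|cd` or `ab|c|d` according to `c ~ d`. -/
theorem facetRow_fibre_b {g : E} (m : Fin 4 → V) (ρ₀ : Config {e // e ≠ g})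
    (h1 : m 1 ∈ G.pcluster g (m 0) ρ₀) (h2 : m 2 ∉ G.pcluster g (m 0) ρ₀) (h3 : m 3 ∉ G.pcluster g (m 0) ρ₀)
    {B : Finset {e // e ≠ g}} (hB : B ⊆ G.outF g (m 0) ρ₀) :
    G.facetRow g m true (cfgOf (G.pkey g (m 0) ρ₀) B) =
      if decide (G.Conn (extendAt g true (cfgOf (G.pkey g (m 0) ρ₀) B)) (m 2) (m 3)) then 3 else 4 := by
  rw [← rowOf4_fibre_b]
  simp only [facetRow, row4]
  congr 1
  funext i
  rw [G.atoms4_markedPartition]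
  fin_cases i
  · exact @decide_eq_true _ _ ((G.conn_fibre_zero_iff m ρ₀ hB 1).2 h1)
  · exact @decide_eq_false _ _ (fun h => h2 ((G.conn_fibre_zero_iff m ρ₀ hB 2).1 h))
  · exact @decide_eq_false _ _ (fun h => h3 ((G.conn_fibre_zero_iff m ρ₀ hB 3).1 h))
  · exact @decide_eq_false _ _ (G.not_conn_fibre m ρ₀ hB h1 h2)
  · exact @decide_eq_false _ _ (G.not_conn_fibre m ρ₀ hB h1 h3)
  · rfl

open Classical in
/-- The X-row on a fibre whose cluster contains `m 2` only: `ac|bd` or `ac|b|d` according to `b ~ d`. -/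
theorem facetRow_fibre_c {g : E} (m : Fin 4 → V) (ρ₀ : Config {e // e ≠ g})
    (h1 : m 1 ∉ G.pcluster g (m 0) ρ₀) (h2 : m 2 ∈ G.pcluster g (m 0) ρ₀) (h3 : m 3 ∉ G.pcluster g (m 0) ρ₀)
    {B : Finset {e // e ≠ g}} (hB : B ⊆ G.outF g (m 0) ρ₀) :
    G.facetRow g m true (cfgOf (G.pkey g (m 0) ρ₀) B) =
      if decide (G.Conn (extendAt g true (cfgOf (G.pkey g (m 0) ρ₀) B)) (m 1) (m 3)) then 6 else 7 := by
  rw [← rowOf4_fibre_c]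
  simp only [facetRow, row4]
  congr 1
  funext i
  rw [G.atoms4_markedPartition]
  fin_cases i
  · exact @decide_eq_false _ _ (fun h => h1 ((G.conn_fibre_zero_iff m ρ₀ hB 1).1 h))
  · exact @decide_eq_true _ _ ((G.conn_fibre_zero_iff m ρ₀ hB 2).2 h2)
  · exact @decide_eq_false _ _ (fun h => h3 ((G.conn_fibre_zero_iff m ρ₀ hB 3).1 h))
  · exact @decide_eq_false _ _ (fun h => G.not_conn_fibre m ρ₀ hB h2 h1 h.symm)
  · rfl
  · exact @decide_eq_false _ _ (G.not_conn_fibre m ρ₀ hB h2 h3)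

open Classical in
/-- The X-row on a fibre whose cluster contains `m 3` only: `ad|bc` or `ad|b|c` according to `b ~ c`. -/
theorem facetRow_fibre_d {g : E} (m : Fin 4 → V) (ρ₀ : Config {e // e ≠ g})
    (h1 : m 1 ∉ G.pcluster g (m 0) ρ₀) (h2 : m 2 ∉ G.pcluster g (m 0) ρ₀) (h3 : m 3 ∈ G.pcluster g (m 0) ρ₀)
    {B : Finset {e // e ≠ g}} (hB : B ⊆ G.outF g (m 0) ρ₀) :
    G.facetRow g m true (cfgOf (G.pkey g (m 0) ρ₀) B) =
      if decide (G.Conn (extendAt g true (cfgOf (G.pkey g (m 0) ρ₀) B)) (m 1) (m 2)) then 8 else 11 := by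
  rw [← rowOf4_fibre_d]
  simp only [facetRow, row4]
  congr 1
  funext i
  rw [G.atoms4_markedPartition]
  fin_cases i
  · exact @decide_eq_false _ _ (fun h => h1 ((G.conn_fibre_zero_iff m ρ₀ hB 1).1 h))
  · exact @decide_eq_false _ _ (fun h => h2 ((G.conn_fibre_zero_iff m ρ₀ hB 2).1 h))
  · exact @decide_eq_true _ _ ((G.conn_fibre_zero_iff m ρ₀ hB 3).2 h3)
  · rfl
  · exact @decide_eq_false _ _ (fun h => G.not_conn_fibre m ρ₀ hB h3 h1 h.symm)
  · exact @decide_eq_false _ _ (fun h => G.not_conn_fibre m ρ₀ hB h3 h2 h.symm)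

/-- **On a fibre whose cluster does not contain exactly one mark, `kf` vanishes.** -/
theorem fibre_sum_zero {g : E} (m : Fin 4 → V) (ρ₀ : Config {e // e ≠ g})
    (hnot : ¬ ((m 1 ∈ G.pcluster g (m 0) ρ₀ ∧ m 2 ∉ G.pcluster g (m 0) ρ₀ ∧ m 3 ∉ G.pcluster g (m 0) ρ₀) ∨
      (m 1 ∉ G.pcluster g (m 0) ρ₀ ∧ m 2 ∈ G.pcluster g (m 0) ρ₀ ∧ m 3 ∉ G.pcluster g (m 0) ρ₀) ∨
      (m 1 ∉ G.pcluster g (m 0) ρ₀ ∧ m 2 ∉ G.pcluster g (m 0) ρ₀ ∧ m 3 ∈ G.pcluster g (m 0) ρ₀)))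
    {B : Finset {e // e ≠ g}} (hB : B ⊆ G.outF g (m 0) ρ₀) (t : Fin 15) :
    kf (G.facetRow g m true (cfgOf (G.pkey g (m 0) ρ₀) B)) t = 0 := by
  classical
  simp only [facetRow, row4]
  set σ := G.markedPartition (extendAt g true (cfgOf (G.pkey g (m 0) ρ₀) B)) m with hσ
  have hv := isEquivAtoms4_atoms4 σ
  have e1 : atoms4 σ 0 = decide (m 1 ∈ G.pcluster g (m 0) ρ₀) := by
    rw [hσ, G.atoms4_markedPartition]
    exact decide_eq_decide.2 (G.conn_fibre_zero_iff m ρ₀ hB 1)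
  have e2 : atoms4 σ 1 = decide (m 2 ∈ G.pcluster g (m 0) ρ₀) := by
    rw [hσ, G.atoms4_markedPartition]
    exact decide_eq_decide.2 (G.conn_fibre_zero_iff m ρ₀ hB 2)
  have e3 : atoms4 σ 2 = decide (m 3 ∈ G.pcluster g (m 0) ρ₀) := by
    rw [hσ, G.atoms4_markedPartition]
    exact decide_eq_decide.2 (G.conn_fibre_zero_iff m ρ₀ hB 3)
  have H : ¬ ((atoms4 σ 0 = true ∧ atoms4 σ 1 = false ∧ atoms4 σ 2 = false) ∨
      (atoms4 σ 0 = false ∧ atoms4 σ 1 = true ∧ atoms4 σ 2 = false) ∨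
      (atoms4 σ 0 = false ∧ atoms4 σ 1 = false ∧ atoms4 σ 2 = true)) := by
    rw [e1, e2, e3]
    simpa only [decide_eq_true_iff, decide_eq_false_iff_not] using hnot
  rw [vec6_eta (atoms4 σ)] at hv ⊢
  exact kf_eq_zero_of_not_one _ _ _ _ _ _ hv H t

/-- **The main lemma: `0 ≤ Σ_ρ kf (f₁ ρ) (f₁ ρᶜ)`**, fibre by fibre. -/
theorem sum_kf_nonneg {g : E} (m : Fin 4 → V) (hg : G.fst g = m 0 ∨ G.snd g = m 0) :
    0 ≤ ∑ ρ : Config {e // e ≠ g}, (kf (G.facetRow g m true ρ) (G.facetRow g m true ρᶜ) : ℝ) := by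
  classical
  rw [← Finset.sum_fiberwise_of_maps_to (s := univ) (t := univ.image (G.pkey g (m 0)))
    (g := G.pkey g (m 0)) (fun ρ _ => Finset.mem_image_of_mem _ (Finset.mem_univ ρ))]
  refine Finset.sum_nonneg fun v hv => ?_
  obtain ⟨ρ₀, -, rfl⟩ := Finset.mem_image.1 hv
  rw [G.fibre_eq_image ρ₀, Finset.sum_image (G.cfgOf_pkey_injOn ρ₀)]
  by_cases h1 : m 1 ∈ G.pcluster g (m 0) ρ₀ <;> by_cases h2 : m 2 ∈ G.pcluster g (m 0) ρ₀ <;>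
    by_cases h3 : m 3 ∈ G.pcluster g (m 0) ρ₀
  · exact Finset.sum_nonneg fun B hB => by
      rw [G.fibre_sum_zero m ρ₀ (by tauto) (Finset.mem_powerset.1 hB)]; simp
  · exact Finset.sum_nonneg fun B hB => by
      rw [G.fibre_sum_zero m ρ₀ (by tauto) (Finset.mem_powerset.1 hB)]; simp
  · exact Finset.sum_nonneg fun B hB => by
      rw [G.fibre_sum_zero m ρ₀ (by tauto) (Finset.mem_powerset.1 hB)]; simp
  · -- only `m 1` in the cluster
    exact G.fibre_sum_nonneg m hg ρ₀ 3 (by decide) 2 3 5 rfl h2 (fun t ht => (badRows_sep t).1 ht)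
      (fun B hB => G.facetRow_fibre_b m ρ₀ h1 h2 h3 hB)
  · exact Finset.sum_nonneg fun B hB => by
      rw [G.fibre_sum_zero m ρ₀ (by tauto) (Finset.mem_powerset.1 hB)]; simp
  · -- only `m 2` in the cluster
    exact G.fibre_sum_nonneg m hg ρ₀ 6 (by decide) 1 3 4 rfl h1 (fun t ht => (badRows_sep t).2.1 ht)
      (fun B hB => G.facetRow_fibre_c m ρ₀ h1 h2 h3 hB)
  · -- only `m 3` in the cluster
    exact G.fibre_sum_nonneg m hg ρ₀ 8 (by decide) 1 2 3 rfl h1 (fun t ht => (badRows_sep t).2.2 ht)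
      (fun B hB => G.facetRow_fibre_d m ρ₀ h1 h2 h3 hB)
  · exact Finset.sum_nonneg fun B hB => by
      rw [G.fibre_sum_zero m ρ₀ (by tauto) (Finset.mem_powerset.1 hB)]; simp

/-! ### Assembly -/

/-- **`X(f₁, f₁) ≤ X(f₁, f₀)`** for a pendant mark: the C-011 cross sum of the contracted map against itself is at most
its cross sum against the `g`-closed map. -/
theorem crossSum_facetRow_le {g : E} (m : Fin 4 → V) (hn : [m 0, m 1, m 2, m 3].Nodup)
    (hg : G.fst g = m 0 ∨ G.snd g = m 0) (hpend : ∀ e, (G.fst e = m 0 ∨ G.snd e = m 0) → e = g) :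
    crossSum phiPlusKernel (G.facetRow g m true) (G.facetRow g m true) ≤
      crossSum phiPlusKernel (G.facetRow g m true) (G.facetRow g m false) := by
  classical
  unfold crossSum
  -- the `g`-closed row is the split row
  have hsplit : ∀ ρ : Config {e // e ≠ g}, G.facetRow g m false ρᶜ = splitA (G.facetRow g m true ρᶜ) :=
    fun ρ => G.row4_extendAt_false hn hg hpend ρᶜ
  simp only [hsplit, phiPlusKernel_eq_kplusZ]
  -- the involution moves the `(⊤, A-row)` count to the `(A-row, ⊤)` side
  have hinv : ∑ ρ : Config {e // e ≠ g},
      ((if G.facetRow g m true ρ = 0 ∧ G.facetRow g m true ρᶜ ∈ aRows then 1 else 0 : ℤ) : ℝ) =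
      ∑ ρ : Config {e // e ≠ g},
        ((if G.facetRow g m true ρ ∈ aRows ∧ G.facetRow g m true ρᶜ = 0 then 1 else 0 : ℤ) : ℝ) := by
    refine Fintype.sum_equiv (complPerm (S := {e // e ≠ g})) _ _ fun ρ => ?_
    simp only [complPerm, Function.Involutive.coe_toPerm, compl_compl]
    by_cases h1 : G.facetRow g m true ρ = 0 <;> by_cases h2 : G.facetRow g m true ρᶜ ∈ aRows <;>
      simp [h1, h2, and_comm]
  have hpt : ∀ ρ : Config {e // e ≠ g},
      ((kplusZ (G.facetRow g m true ρ) (G.facetRow g m true ρᶜ) : ℤ) : ℝ) -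
          kplusZ (G.facetRow g m true ρ) (splitA (G.facetRow g m true ρᶜ)) +
        ((if G.facetRow g m true ρ = 0 ∧ G.facetRow g m true ρᶜ ∈ aRows then 1 else 0 : ℤ) : ℝ) -
        ((if G.facetRow g m true ρ ∈ aRows ∧ G.facetRow g m true ρᶜ = 0 then 1 else 0 : ℤ) : ℝ) ≤
        -(kf (G.facetRow g m true ρ) (G.facetRow g m true ρᶜ) : ℝ) := by
    intro ρ
    exact_mod_cast kd_le_neg_kf (G.facetRow g m true ρ) (G.facetRow g m true ρᶜ)
  have hsum := Finset.sum_le_sum fun ρ (_ : ρ ∈ (univ : Finset (Config {e // e ≠ g}))) => hpt ρ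
  have hkf := G.sum_kf_nonneg m hg
  simp only [Finset.sum_add_distrib, Finset.sum_sub_distrib, Finset.sum_neg_distrib] at hsum
  linarith

/-- **`(5a)_class` in typer-2's form: `CS₁(G, g) ≤ 2·CS(G)` for every pendant mark.** -/
theorem cubeSumC011Con_le_two_mul {g : E} (a b c d : V) (hn : [a, b, c, d].Nodup)
    (hg : G.fst g = a ∨ G.snd g = a) (hpend : ∀ e, (G.fst e = a ∨ G.snd e = a) → e = g) :
    G.cubeSumC011Con g ![a, b, c, d] ≤ 2 * G.cubeSumC011 ![a, b, c, d] := by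
  have h01 : a ≠ b := by simp only [List.nodup_cons, List.mem_cons] at hn; tauto
  have h02 : a ≠ c := by simp only [List.nodup_cons, List.mem_cons] at hn; tauto
  have h03 : a ≠ d := by simp only [List.nodup_cons, List.mem_cons] at hn; tauto
  rw [G.cubeSumC011_eq_facets g, G.cubeSumC011Con_eq_facets g]
  have h0 : crossSum phiPlusKernel (G.facetRow g ![a, b, c, d] false) (G.facetRow g ![a, b, c, d] true) = 0 := by
    unfold crossSum
    refine Finset.sum_eq_zero fun ρ _ => ?_
    simp only [facetRow]
    rw [← update_extendAt g true false ρ]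
    exact G.phiPlusKernel_closed_eq_zero h01 h02 h03 hpend _ _
  have hmain := G.crossSum_facetRow_le ![a, b, c, d] (by simpa using hn) hg hpend
  rw [h0]
  linarith

end MultiGraph

/-- **THE CLASS-LEVEL PENDANT LEMMA 5a** (`(5a)_class`, p1 §T; proofs/P1-5a-class.md): the class sum of the
Lemma-5 kernel along the edge of a pendant mark is nonnegative on the full cube of every marked multigraph. -/
theorem pendantClassSumNonneg_holds : PendantClassSumNonneg := by
  rw [pendantClassSumNonneg_iff]
  intro V E _ _ G g a b c d hn hg hpend
  exact G.cubeSumC011Con_le_two_mul a b c d hn hg hpend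

end PercRepro
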